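import Literature.NumberTheory.GaloisRepresentations.QuadraticArtinIndicator
import Literature.NumberTheory.AdelicBaseChange.AdeleNormArchimedean
import Literature.NumberTheory.AdelicBaseChange.AdeleNormGalois
import Mathlib.RingTheory.Complex
import HarnessLib

/-!
# A trivial quadratic Artin indicator with positive archimedean components is represented by a TOTALLY POSITIVE global element
# (O'Meara 71:19 with the sign bookkeeping at the real places; the `ξ ≫ 0` of Rogawski 1990 §3.3 Prop. 3.3.1 at a singular class, §3.8 Prop. 3.8.1 (d))

Topic `NumberTheory/GaloisRepresentations`; namespace `Literature.NumberTheory.GaloisRepresentations` (home of ★ `quadraticArtinIndicator`); **THEOREMS ONLY**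
(no definition, no named fact, no instance, no notation, no `sorry`).  Cell `pub/hodgecm-mathlib`, ENGINE T1 (crux H413 = `stmt-HodgeConjecture-24833`), O7
«singular semisimple classes», row (P2-s) (CENSUS-O7 v3 §3; TRUNK WORDS #5): the companion of ★ `QuadraticForms/HermitianDefiniteRealisation` ((R6a-s)).

* `embedding_pos_of_eq_mul_ideleRelNorm` — if an idèle `X` of `K` is `(k) · N_{E∕K}(Z)` with `E` having no real place and `X_v > 0` at a real place `v`,
  then `σ_v(k) > 0` (`N_{E∕K}(Z)_v = ∏_{w∣v} |z_w|² > 0`, (19.19) ★ `adeleRelNorm_fst_apply_eq_prod` + `N_{ℂ∕ℝ} = |·|²`; the place-by-place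
  positivity is ★ `NumberFields.ideleRelNorm_fst_pos`, re-derived here for a totally imaginary `E` over ★ `AdeleNormArchimedean` only);
* **`exists_totallyPositive_mul_ideleRelNorm_eq`** — `quadraticArtinIndicator K d X = 0` (★ `…_eq_zero_iff_exists_ideleRelNorm`: `X ∈ Kˣ · N_{E∕K}(𝕀_E)`) and
  `X_v > 0` at every real `v` ⇒ `X = (k) · N(Z)` with `k` positive at every real place of `K`;
* `re_pos_of_forall_isReal_embedding_pos`, **`exists_re_pos_mul_ideleRelNorm_eq_cm`** — the CM reading (`K = L⁺`, `E = L`): `Re τ(k) > 0` at every complex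
  embedding `τ` of `L`, the currency of ★ `Landherr.exists_hermitian_signature_det_eq_mul` ∕ ★ `Rogawski1990.exists_commute_hermStar_eq_of_frame`.

HONEST LABEL: idelic sign bookkeeping; nothing printed is consumed; HC_CM is proved only modulo the printed citations until rung 0 closes.

## References
* [Omeara1963] O. T. O'Meara, *Introduction to Quadratic Forms* (1963), §71 Thm. 71:19 (`Kˣ · N(𝕀_E)` has index 2).
* [CasselsFrohlichANT1967] Cassels–Fröhlich (eds.), *Algebraic Number Theory* (1967), Ch. II §19 (19.19) (archimedean components of the norm).
* [Rogawski1990] J. D. Rogawski, Ann. of Math. Stud. 123 (1990), §3.3 Prop. 3.3.1 p. 22, §3.8 Prop. 3.8.1 (d) p. 27.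
-/

set_option autoImplicit false

noncomputable section

open NumberField

namespace Literature.NumberTheory.GaloisRepresentations

open NumberField.InfinitePlace NumberField.InfinitePlace.Completion
open Literature.NumberTheory.Automorphic
-- to enable `w.1.LiesOver v.1 → Algebra v.Completion w.Completion`
open scoped NumberField.LiesOver

section TotallyPositive

variable {K E : Type} [Field K] [NumberField K] [Field E] [NumberField E] [Algebra K E]

omit [NumberField K] in
/-- `r_v(k) = σ_v(k)` for `k ∈ K` at a real place `v` (the extension to `K_v` of the real embedding, on `K`). [folklore] -/
private theorem extensionEmbeddingOfIsReal_coe_eq' {v : InfinitePlace K} (hv : v.IsReal) (k : K) :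
    extensionEmbeddingOfIsReal hv (k : v.Completion) = embedding_of_isReal hv k := by
  rw [show ((k : K) : v.Completion) = ((WithAbs.toAbs v.1 k : WithAbs v.1) : v.Completion) from rfl, extensionEmbeddingOfIsReal_coe]
  rfl

omit [NumberField K] [NumberField E] in
/-- `N_{E_w∕K_v} y = |y|²` read in `ℝ`, for a COMPLEX place `w` over the real place `v` (Mathlib `Algebra.norm_eq_of_equiv_equiv` along
`K_v ≅ ℝ`, `E_w ≅ ℂ`, and `Algebra.norm_complex_apply`); private copy of ★ `NumberFields.extensionEmbeddingOfIsReal_norm_of_isComplex`.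
[cite: CasselsFrohlichANT1967, Ch. II §19 (19.19)] -/
private theorem extensionEmbeddingOfIsReal_norm_of_isComplex' {v : InfinitePlace K} (w : InfinitePlace E) [w.1.LiesOver v.1]
    (hv : v.IsReal) (hw : w.IsComplex) (y : w.Completion) :
    extensionEmbeddingOfIsReal hv (Algebra.norm v.Completion y) = Complex.normSq (extensionEmbedding w y) := by
  have := LiesOver.extensionEmbedding_liesOver_of_isReal w hv
  have he : (algebraMap ℝ ℂ).comp (ringEquivRealOfIsReal hv : v.Completion →+* ℝ) =
      (ringEquivComplexOfIsComplex hw : w.Completion →+* ℂ).comp (algebraMap v.Completion w.Completion) := by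
    ext; simp
  rw [Algebra.norm_eq_of_equiv_equiv (ringEquivRealOfIsReal hv) (ringEquivComplexOfIsComplex hw) he y,
    ← ringEquivRealOfIsReal_apply hv, RingEquiv.apply_symm_apply, Algebra.norm_complex_apply,
    ringEquivComplexOfIsComplex_apply]

/-- `(N_{E∕K} Z)_v > 0` at a real place `v` of `K` when `E` has no real place: every local norm from a complex `E_w` is `|z_w|² > 0`
(private re-derivation of ★ `NumberFields.ideleRelNorm_fst_pos` for totally imaginary `E`). [cite: CasselsFrohlichANT1967, Ch. II §19 (19.19)] -/
private theorem ideleRelNorm_fst_pos_of_not_isReal [IsGalois K E] (hE : ∀ w : InfinitePlace E, ¬ w.IsReal) (Z : ideleGroup E)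
    {v : InfinitePlace K} (hv : v.IsReal) :
    0 < extensionEmbeddingOfIsReal hv (((AdeleRing.ideleRelNorm K E Z : ideleGroup K) : AdeleRing (𝓞 K) K).1 v) := by
  rw [Literature.NumberTheory.AdelicBaseChange.automorphic_ideleRelNorm_eq, Literature.NumberTheory.AdelicBaseChange.coe_ideleRelNorm,
    Literature.NumberTheory.AdelicBaseChange.adeleRelNorm_fst_apply_eq_prod, map_prod]
  refine Finset.prod_pos fun w _ => ?_
  have hne : (Z : AdeleRing (𝓞 E) E).1 w.1 ≠ 0 := by
    have h := congrArg (fun z : AdeleRing (𝓞 E) E => z.1 w.1) Z.inv_mul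
    change ((Z⁻¹ : ideleGroup E) : AdeleRing (𝓞 E) E).1 w.1 * (Z : AdeleRing (𝓞 E) E).1 w.1 = 1 at h
    exact right_ne_zero_of_mul_eq_one h
  rw [extensionEmbeddingOfIsReal_norm_of_isComplex' w.1 hv (InfinitePlace.not_isReal_iff_isComplex.1 (hE w.1)), Complex.normSq_pos]
  exact (map_ne_zero (extensionEmbedding w.1)).mpr hne

/-- **Sign bookkeeping at a real place.**  If an idèle `X` of `K` is `(k) · N_{E∕K}(Z)` with `E` having NO real place (e.g. `E` CM) and `X_v > 0`
at the real place `v` of `K`, then `σ_v(k) > 0` — because `N_{E∕K}(Z)_v = ∏_{w∣v} |z_w|² > 0` (★ `ideleRelNorm_fst_pos`).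
[cite: CasselsFrohlichANT1967, Ch. II §19 (19.19)] -/
theorem embedding_pos_of_eq_mul_ideleRelNorm [IsGalois K E] (hE : ∀ w : InfinitePlace E, ¬ w.IsReal) {X : ideleGroup K} {k : Kˣ} {Z : ideleGroup E}
    (hX : X = Units.map (algebraMap K (AdeleRing (𝓞 K) K)).toMonoidHom k * AdeleRing.ideleRelNorm K E Z)
    {v : InfinitePlace K} (hv : v.IsReal) (hXv : 0 < extensionEmbeddingOfIsReal hv ((X : AdeleRing (𝓞 K) K).1 v)) :
    0 < embedding_of_isReal hv (k : K) := by
  have hN : 0 < extensionEmbeddingOfIsReal hv (((AdeleRing.ideleRelNorm K E Z : ideleGroup K) : AdeleRing (𝓞 K) K).1 v) :=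
    ideleRelNorm_fst_pos_of_not_isReal hE Z hv
  have hcomp : (X : AdeleRing (𝓞 K) K).1 v = (k : v.Completion) * (((AdeleRing.ideleRelNorm K E Z : ideleGroup K) : AdeleRing (𝓞 K) K).1 v) := by
    rw [hX]
    rfl
  rw [hcomp, map_mul, extensionEmbeddingOfIsReal_coe_eq'] at hXv
  exact pos_of_mul_pos_left hXv hN.le

/-- **(P2-s) A TRIVIAL QUADRATIC ARTIN INDICATOR WITH POSITIVE ARCHIMEDEAN COMPONENTS IS REPRESENTED BY A TOTALLY POSITIVE GLOBAL ELEMENT.**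
For `E∕K` quadratic Galois (`σ`, `δ² = d`), `E` with no real place, and an idèle `X` of `K` with `quadraticArtinIndicator K d X = 0` (★
`…_eq_zero_iff_exists_ideleRelNorm`: `X ∈ Kˣ · N_{E∕K}(𝕀_E)`) which is positive at every real place of `K`: `X = (k) · N(Z)` with `k ∈ Kˣ` POSITIVE AT
EVERY REAL PLACE of `K`.  (At a singular class of `U(3)` this is the global representative `ξ ≫ 0` of the block-determinant class that ★ §2
`exists_commute_hermStar_eq_of_frame` realises.) [cite: Rogawski1990, §3.3 Prop. 3.3.1 p. 22; §3.8 Prop. 3.8.1 (d) p. 27] [cite: Omeara1963, §71 Thm. 71:19] -/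
theorem exists_totallyPositive_mul_ideleRelNorm_eq [IsGalois K E] [Algebra.IsQuadraticExtension K E] (σ : E ≃ₐ[K] E) {δ : E} (hσδ : σ δ = -δ)
    (hδ : δ ≠ 0) {d : K} (hd : δ * δ = algebraMap K E d) (hE : ∀ w : InfinitePlace E, ¬ w.IsReal) {X : ideleGroup K}
    (h0 : quadraticArtinIndicator K d X = 0)
    (hXpos : ∀ (v : InfinitePlace K) (hv : v.IsReal), 0 < extensionEmbeddingOfIsReal hv ((X : AdeleRing (𝓞 K) K).1 v)) :
    ∃ (k : Kˣ) (Z : ideleGroup E), X = Units.map (algebraMap K (AdeleRing (𝓞 K) K)).toMonoidHom k * AdeleRing.ideleRelNorm K E Z ∧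
      ∀ (v : InfinitePlace K) (hv : v.IsReal), 0 < embedding_of_isReal hv (k : K) := by
  obtain ⟨k, Z, hX⟩ := (quadraticArtinIndicator_eq_zero_iff_exists_ideleRelNorm σ hσδ hδ hd X).1 h0
  exact ⟨k, Z, hX, fun v hv => embedding_pos_of_eq_mul_ideleRelNorm hE hX hv (hXpos v hv)⟩

end TotallyPositive

section CM

variable {L : Type} [Field L] [NumberField L] [IsCMField L]

/-- A CM field has no real place. [folklore] -/
private theorem not_isReal_of_isCMField (w : InfinitePlace L) : ¬ w.IsReal := fun hw =>
  InfinitePlace.not_isReal_iff_isComplex.2 (IsTotallyComplex.isComplex w) hw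

omit [NumberField L] [IsCMField L] in
/-- **The CM reading of total positivity**: an element `k` of the maximal real subfield `L⁺` which is positive at every (real) place of `L⁺` has
`Re τ(k) > 0` at every complex embedding `τ` of `L` — the currency of ★ `Landherr.exists_hermitian_signature_det_eq_mul` ∕
★ `Rogawski1990.exists_commute_hermStar_eq_of_frame`. [cite: Landherr1936HermitianForms] -/
theorem re_pos_of_forall_isReal_embedding_pos {k : ↥(maximalRealSubfield L)}
    (hk : ∀ (v : InfinitePlace ↥(maximalRealSubfield L)) (hv : v.IsReal), 0 < embedding_of_isReal hv k) (τ : L →+* ℂ) :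
    0 < (τ (k : L)).re := by
  set φ : ↥(maximalRealSubfield L) →+* ℂ := τ.comp (algebraMap ↥(maximalRealSubfield L) L) with hφ
  have hφr : ComplexEmbedding.IsReal φ := by
    rw [ComplexEmbedding.isReal_iff]
    ext x
    exact x.2 τ
  have hv : (InfinitePlace.mk φ).IsReal := ⟨φ, hφr, rfl⟩
  have h := hk (InfinitePlace.mk φ) hv
  have he : ((embedding_of_isReal hv k : ℝ) : ℂ) = φ k := by
    rw [embedding_of_isReal_apply, embedding_mk_eq_of_isReal hφr]
  have hre : (τ (k : L)).re = embedding_of_isReal hv k := by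
    have : τ (k : L) = φ k := rfl
    rw [this, ← he, Complex.ofReal_re]
  rw [hre]; exact h

/-- **(P2-s), CM form**: for the CM field `L` over `L⁺` (`σ` = complex conjugation, `δ² = d`, `σ δ = −δ`), an idèle `X` of `L⁺` with trivial quadratic
Artin indicator and positive archimedean components is `(k) · N_{L∕L⁺}(Z)` with `k ∈ (L⁺)ˣ` and `Re τ(k) > 0` at EVERY complex embedding `τ` of `L`
— the `ξ` of ★ §2 `exists_commute_hermStar_eq_of_frame`. [cite: Rogawski1990, §3.3 Prop. 3.3.1 p. 22; §3.8 Prop. 3.8.1 (d) p. 27] [cite: Omeara1963, §71 Thm. 71:19] -/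
theorem exists_re_pos_mul_ideleRelNorm_eq_cm (σ : L ≃ₐ[↥(maximalRealSubfield L)] L) {δ : L} (hσδ : σ δ = -δ) (hδ : δ ≠ 0)
    {d : ↥(maximalRealSubfield L)} (hd : δ * δ = algebraMap _ L d) {X : ideleGroup ↥(maximalRealSubfield L)}
    (h0 : quadraticArtinIndicator ↥(maximalRealSubfield L) d X = 0)
    (hXpos : ∀ (v : InfinitePlace ↥(maximalRealSubfield L)) (hv : v.IsReal),
      0 < extensionEmbeddingOfIsReal hv ((X : AdeleRing (𝓞 ↥(maximalRealSubfield L)) ↥(maximalRealSubfield L)).1 v)) :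
    ∃ (k : (↥(maximalRealSubfield L))ˣ) (Z : ideleGroup L),
      X = Units.map (algebraMap _ (AdeleRing (𝓞 ↥(maximalRealSubfield L)) ↥(maximalRealSubfield L))).toMonoidHom k *
        AdeleRing.ideleRelNorm ↥(maximalRealSubfield L) L Z ∧
      ∀ τ : L →+* ℂ, 0 < (τ ((k : ↥(maximalRealSubfield L)) : L)).re := by
  obtain ⟨k, Z, hX, hk⟩ := exists_totallyPositive_mul_ideleRelNorm_eq σ hσδ hδ hd not_isReal_of_isCMField h0 hXpos
  exact ⟨k, Z, hX, re_pos_of_forall_isReal_embedding_pos hk⟩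

end CM

end Literature.NumberTheory.GaloisRepresentations

end
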